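/-
Copyright (c) 2026 the pub-hodgecm-mathlib formalisation cell (harness21).  Prover seat hodgecm-mathlib-F0P3a-p07 (g13), 2026-09-02.  Road «S3-ram» seeding wave (LEAD T11-41∕T11-60; owner F0P3a-p06 (g15));
(α₂) organ A₂ (d-iii-0) «RECONSTRUCTION ∕ GLUING SET» for the type-(2) G-side (architect A-p12 (g23); design memo `DESIGN-A2d-TypeTwoGSide.v1_1` §2 (d-iii-0), v1.2 §3).
-/
import Literature.NumberTheory.Automorphic.UnitaryLatticeTreeBlockSelfDualData   -- ★ p847272 (this seat): (SD-W), (SD-e); ⊇ ★ p847252 `pairing_single_{left,right}_of_block`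
import HarnessLib

/-!
# The lattice graph of a hermitian space — GLUING a line onto a W-lattice: the lattices `B ⊔ 𝒪x₀` off the axis, their dual, and when they are self-dual
# (Jacobowitz 1962 §4; Bruhat–Tits 1972 §10; Kottwitz 1986 §3)

Topic `NumberTheory/Automorphic`; namespace `Literature.NumberTheory.Automorphic.UnitaryLatticeTree`.  THEOREMS ONLY (no definition, no instance, no notation, no named fact,
no `sorry`); kernel lane `--supports stmt-HodgeConjecture-24833`; datum-free (`K` with `Valued K ℤᵐ⁰`, `σ` valuation-preserving).  Cell `pub/hodgecm-mathlib`, crux H413 =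
`stmt-HodgeConjecture-24833`; road «S3-ram» (count-neutral), (α₂) P-2-ram (architect A-p12 (g23)) organ A₂ (d) «type-(2) G-side counts», part **(d-iii-0) RECONSTRUCTION ∕
GLUING SET** (memo `F0/P3a/F0P3a-p07/g13/type2G/DESIGN-A2d-TypeTwoGSide.v1_1.F0P3ap07g13.md` §2; the coordinates `(ℓ, c)` of the COLLAR law, memo v1.2 §2–§3).  Seat F0P3a-p07 (g13).
HONEST LABEL: HC_CM is proved only modulo the cell's 2 remaining named inputs (hLiu418 24832, h413 24833) until rung 0 closes; nothing printed is asserted here (elementary lattice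
algebra over a valuation ring).

THE MATHEMATICS.  `V = K³ = W_i ⊕ Ke_i`, form `H` BLOCK at `i` (`H_{li} = H_{il} = 0` for `l ≠ i`, `|H_{ii}| = 1`), `⟨x, y⟩ = (σx)ᵀ H y`, `|⟨y, x⟩| = |⟨x, y⟩|` (hermitian `H`,
`pairing_comm_of_hermitian`).  An off-axis lattice is GLUED from its W-part: for `B ⊆ W_i` and `x₀ = w₀ + c₀e_i` (`w₀ ∈ W_i`, `|c₀| > 1`) put `M = B ⊔ 𝒪x₀`.
* §1 GENERATION: any `M` whose `i`-coordinates are maximised at `x₁ ∈ M` is `(M ∩ W_i) + 𝒪x₁` (`mem_iff_exists_sub_smul_mem_of_coord_le`).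
* §2 `y ∈ M^♯ ⟺ |⟨B, y⟩| ≤ 1 ∧ |⟨x₀, y⟩| ≤ 1` (`mem_dualLatt_sup_span_iff`).
* §3 **THE GLUING THEOREM** (`dualLatt_sup_span_eq_of_glue`): if **(G1)** `B` is the dual of `B + 𝒪w₀` inside `W_i` — `∀ w ∈ W_i, w ∈ B ⟺ |⟨B, w⟩| ≤ 1 ∧ |⟨x₀, w⟩| ≤ 1` — and
  **(G2)** `|⟨x₀, x₀⟩| ≤ 1` (the glued generator is integrally isotropic: `⟨w₀,w₀⟩_W + σ(c₀)H_{ii}c₀ ∈ 𝒪`), then **`M^♯ = M`**: `M` is self-dual.  On the way: `s·w₀ ∈ B` whenever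
  `|s|·|c₀|² ≤ 1` (`smul_sub_single_mem_of_glue`) and `d·e_i ∈ M` whenever `|d|·|c₀| ≤ 1` (`single_mem_sup_span_of_glue`) — so `M ∩ Ke_i = c₀⁻¹𝒪e_i`, `pr_e M = c₀𝒪e_i`: the tube
  coordinate of `M` is `a = v(c₀⁻¹)` (memo v1.2 (L1)).
* §4 `d·e_i ∈ M ⟺ |d|·|c₀| ≤ 1` (`single_mem_sup_span_iff_of_glue`): two gluings `x₀, x₀ + d e_i` give the SAME `M` iff `|d| ≤ |c₀|⁻¹` — the gluing parameter lives in
  `c₀(1 + 𝒪c₀⁻²)`-classes, i.e. `c₀ mod 𝒪·c₀⁻¹` (`sup_span_eq_sup_span_of_glue`).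
Conversely every self-dual `M` with `pr_e M = c₀𝒪e_i`, `|c₀| > 1`, is such a gluing: §1 with ★ (SD-W)∕(SD-e) (p847272) give (G1)(G2) for `x₀ :=` any coordinate-maximal element.

## References
* [Jacobowitz1962] R. Jacobowitz, *Hermitian forms over local fields*, Amer. J. Math. 84 (1962), §4 (dual lattices, gluing of modular components).
* [BruhatTits1972] F. Bruhat, J. Tits, *Groupes réductifs sur un corps local I*, Publ. Math. IHÉS 41 (1972), §10.
* [Kottwitz1986] R. E. Kottwitz, *Base change for unit elements of Hecke algebras*, Compositio Math. 60 (1986), §3.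
-/

set_option autoImplicit false

noncomputable section

open scoped Valued WithZero Matrix MatrixGroups

namespace Literature.NumberTheory.Automorphic.UnitaryLatticeTree

open Literature.NumberTheory.Automorphic Literature.NumberTheory.Automorphic.HermitianLattice

variable {K : Type*} [Field K] [Valued K ℤᵐ⁰]

/-! ## §0 Bookkeeping: hermitian symmetry of `|⟨·,·⟩|`, membership in `B ⊔ 𝒪x₀` -/

omit [Valued K ℤᵐ⁰] in
/-- For a HERMITIAN matrix (`σ(H_{ab}) = H_{ba}`) and an involution `σ`: `⟨y, x⟩ = σ⟨x, y⟩`. [cite: Jacobowitz1962, §4] -/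
theorem pairing_comm_of_hermitian {N : ℕ} {σ : K →+* K} (hσσ : ∀ a, σ (σ a) = a) {H : Matrix (Fin N) (Fin N) K} (hH : ∀ a b, σ (H a b) = H b a)
    (x y : Fin N → K) : pairing σ H y x = σ (pairing σ H x y) := by
  simp only [pairing_apply, map_sum, map_mul, hσσ, hH]
  rw [Finset.sum_comm]
  exact Finset.sum_congr rfl fun a _ => Finset.sum_congr rfl fun b _ => by ring

/-- Hence `|⟨y, x⟩| = |⟨x, y⟩|` for a valuation-preserving involution `σ` and hermitian `H`. [cite: Jacobowitz1962, §4] -/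
theorem v_pairing_comm_of_hermitian {N : ℕ} {σ : K →+* K} (hvσ : ∀ a, Valued.v (σ a) = Valued.v a) (hσσ : ∀ a, σ (σ a) = a)
    {H : Matrix (Fin N) (Fin N) K} (hH : ∀ a b, σ (H a b) = H b a) (x y : Fin N → K) :
    Valued.v (pairing σ H y x) = Valued.v (pairing σ H x y) := by
  rw [pairing_comm_of_hermitian hσσ hH, hvσ]

/-- Membership in `B ⊔ 𝒪x₀`: `y = b + t x₀` with `|t| ≤ 1`, `b ∈ B`. [cite: BruhatTits1972, §10] -/
theorem mem_sup_span_singleton_iff {N : ℕ} {B : Submodule 𝒪[K] (Fin N → K)} {x₀ y : Fin N → K} :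
    y ∈ B ⊔ Submodule.span 𝒪[K] {x₀} ↔ ∃ t : K, Valued.v t ≤ 1 ∧ y - t • x₀ ∈ B := by
  rw [Submodule.mem_sup]
  constructor
  · rintro ⟨b, hb, z, hz, rfl⟩
    obtain ⟨a, rfl⟩ := Submodule.mem_span_singleton.1 hz
    refine ⟨(a : K), (mem_integer_iff' _).1 a.2, ?_⟩
    have e : (a • x₀ : Fin N → K) = (a : K) • x₀ := rfl
    rwa [e, add_sub_cancel_right]
  · rintro ⟨t, ht, hb⟩
    refine ⟨y - t • x₀, hb, t • x₀, ?_, sub_add_cancel _ _⟩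
    have e : ((⟨t, (mem_integer_iff' _).2 ht⟩ : 𝒪[K]) • x₀ : Fin N → K) = t • x₀ := rfl
    exact Submodule.mem_span_singleton.2 ⟨⟨t, (mem_integer_iff' _).2 ht⟩, e⟩

/-! ## §1 Generation: a lattice is its W-part plus one coordinate-maximal vector -/

/-- **GENERATION**: if `x₁ ∈ M` maximises `|m_i|` over `m ∈ M` and `x₁,i ≠ 0`, then `y ∈ M ⟺ y = b + t x₁` with `|t| ≤ 1`, `b ∈ M`, `b_i = 0` — `M = (M ∩ W_i) + 𝒪x₁`.
[cite: BruhatTits1972, §10] [cite: Jacobowitz1962, §4] -/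
theorem mem_iff_exists_sub_smul_mem_of_coord_le {N : ℕ} {M : Submodule 𝒪[K] (Fin N → K)} (i : Fin N) {x₁ : Fin N → K} (hx₁ : x₁ ∈ M) (hx₁i : x₁ i ≠ 0)
    (hmax : ∀ m ∈ M, Valued.v (m i) ≤ Valued.v (x₁ i)) (y : Fin N → K) :
    y ∈ M ↔ ∃ t : K, Valued.v t ≤ 1 ∧ y - t • x₁ ∈ M ∧ (y - t • x₁) i = 0 := by
  constructor
  · intro hy
    refine ⟨y i / x₁ i, ?_, ?_, ?_⟩
    · rw [map_div₀, div_le_one₀ (zero_lt_iff.2 ((Valuation.ne_zero_iff _).2 hx₁i))]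
      exact hmax y hy
    · refine M.sub_mem hy ?_
      have e : ((⟨y i / x₁ i, (mem_integer_iff' _).2 ?_⟩ : 𝒪[K]) • x₁ : Fin N → K) = (y i / x₁ i) • x₁ := rfl
      · rw [← e]; exact M.smul_mem _ hx₁
      · rw [map_div₀, div_le_one₀ (zero_lt_iff.2 ((Valuation.ne_zero_iff _).2 hx₁i))]
        exact hmax y hy
    · rw [Pi.sub_apply, Pi.smul_apply, smul_eq_mul, div_mul_cancel₀ _ hx₁i, sub_self]
  · rintro ⟨t, ht, hb, -⟩
    have e : ((⟨t, (mem_integer_iff' _).2 ht⟩ : 𝒪[K]) • x₁ : Fin N → K) = t • x₁ := rfl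
    have := M.add_mem hb (e ▸ M.smul_mem ⟨t, (mem_integer_iff' _).2 ht⟩ hx₁)
    rwa [sub_add_cancel] at this

/-! ## §2 The dual of a glued lattice is tested on `B` and `x₀` -/

/-- **`y ∈ (B ⊔ 𝒪x₀)^♯ ⟺ (∀ b ∈ B, |⟨b, y⟩| ≤ 1) ∧ |⟨x₀, y⟩| ≤ 1`** (`σ` valuation-preserving). [cite: Jacobowitz1962, §4] -/
theorem mem_dualLatt_sup_span_iff {N : ℕ} {σ : K →+* K} (hvσ : ∀ a, Valued.v (σ a) = Valued.v a) (H : Matrix (Fin N) (Fin N) K)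
    (B : Submodule 𝒪[K] (Fin N → K)) (x₀ y : Fin N → K) :
    y ∈ dualLatt σ H (B ⊔ Submodule.span 𝒪[K] {x₀}) ↔ (∀ b ∈ B, Valued.v (pairing σ H b y) ≤ 1) ∧ Valued.v (pairing σ H x₀ y) ≤ 1 := by
  rw [mem_dualLatt]
  constructor
  · intro h
    exact ⟨fun b hb => h b (Submodule.mem_sup_left hb), h x₀ (Submodule.mem_sup_right (Submodule.mem_span_singleton_self x₀))⟩
  · rintro ⟨hB, hx⟩ m hm
    obtain ⟨t, ht, hb⟩ := mem_sup_span_singleton_iff.1 hm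
    have e : m = (m - t • x₀) + t • x₀ := (sub_add_cancel _ _).symm
    rw [e, map_add, LinearMap.add_apply, LinearMap.map_smulₛₗ, LinearMap.smul_apply, smul_eq_mul]
    refine (Valuation.map_add _ _ _).trans (max_le (hB _ hb) ?_)
    rw [map_mul, hvσ]
    exact mul_le_one' ht hx

/-! ## §3 The gluing theorem: `(B ⊔ 𝒪x₀)^♯ = B ⊔ 𝒪x₀` under (G1)(G2) -/

section Glue

variable {σ : K →+* K} {H : Matrix (Fin 3) (Fin 3) K} {i : Fin 3} {B : Submodule 𝒪[K] (Fin 3 → K)} {x₀ : Fin 3 → K}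

omit [Valued K ℤᵐ⁰] in
/-- Block bookkeeping: `⟨m, x₀ − x₀,i e_i⟩ = ⟨m, x₀⟩ − σ(m_i)H_{ii}x₀,i`. [cite: BruhatTits1972, §10] -/
theorem pairing_sub_single_right_of_block (σ : K →+* K) (H : Matrix (Fin 3) (Fin 3) K) (i : Fin 3) (hHcol : ∀ l, l ≠ i → H l i = 0) (m x₀ : Fin 3 → K) :
    pairing σ H m (x₀ - Pi.single i (x₀ i)) = pairing σ H m x₀ - σ (m i) * H i i * x₀ i := by
  rw [map_sub, pairing_single_right_of_block σ H i hHcol]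

/-- **`s·w₀ ∈ B` for `|s|·|c₀|² ≤ 1`** (`w₀ = x₀ − c₀e_i`, `c₀ = x₀,i`, `|c₀| > 1`), under (G1)(G2): `|⟨b, w₀⟩| = |⟨b, x₀⟩| ≤ 1` and `|⟨x₀, w₀⟩| ≤ |c₀|²`. [cite: Jacobowitz1962, §4] -/
theorem smul_sub_single_mem_of_glue (hvσ : ∀ a, Valued.v (σ a) = Valued.v a) (hsymm : ∀ x y : Fin 3 → K, Valued.v (pairing σ H y x) = Valued.v (pairing σ H x y))
    (hHcol : ∀ l, l ≠ i → H l i = 0) (hhi : Valued.v (H i i) = 1) (hBW : ∀ b ∈ B, b i = 0) (hx₀ : 1 < Valued.v (x₀ i))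
    (hdual : ∀ w : Fin 3 → K, w i = 0 → (w ∈ B ↔ (∀ b ∈ B, Valued.v (pairing σ H b w) ≤ 1) ∧ Valued.v (pairing σ H x₀ w) ≤ 1))
    (hiso : Valued.v (pairing σ H x₀ x₀) ≤ 1) {s : K} (hs : Valued.v s * (Valued.v (x₀ i) * Valued.v (x₀ i)) ≤ 1) :
    s • (x₀ - Pi.single i (x₀ i)) ∈ B := by
  have h1 : (1 : ℤᵐ⁰) ≤ Valued.v (x₀ i) * Valued.v (x₀ i) := one_le_mul hx₀.le hx₀.le
  have hs1 : Valued.v s ≤ 1 := (le_mul_of_one_le_right' h1).trans hs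
  have hwi : (s • (x₀ - Pi.single i (x₀ i)) : Fin 3 → K) i = 0 := by simp
  refine (hdual _ hwi).2 ⟨fun b hb => ?_, ?_⟩
  · rw [map_smul, smul_eq_mul, map_mul, pairing_sub_single_right_of_block σ H i hHcol, hBW b hb, map_zero, zero_mul, zero_mul, sub_zero,
      hsymm x₀ b]
    exact mul_le_one' hs1 ((hdual b (hBW b hb)).1 hb).2
  · rw [map_smul, smul_eq_mul, map_mul, pairing_sub_single_right_of_block σ H i hHcol]
    refine le_trans (mul_le_mul' le_rfl ((Valuation.map_sub _ _ _).trans (max_le (hiso.trans h1) ?_))) hs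
    rw [map_mul, map_mul, hvσ, hhi, mul_one]

/-- **`d·e_i ∈ B ⊔ 𝒪x₀` for `|d|·|c₀| ≤ 1`** under (G1)(G2): `d e_i = (d∕c₀)x₀ − (d∕c₀)w₀`. [cite: Jacobowitz1962, §4] [cite: BruhatTits1972, §10] -/
theorem single_mem_sup_span_of_glue (hvσ : ∀ a, Valued.v (σ a) = Valued.v a) (hsymm : ∀ x y : Fin 3 → K, Valued.v (pairing σ H y x) = Valued.v (pairing σ H x y))
    (hHcol : ∀ l, l ≠ i → H l i = 0) (hhi : Valued.v (H i i) = 1) (hBW : ∀ b ∈ B, b i = 0) (hx₀ : 1 < Valued.v (x₀ i))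
    (hdual : ∀ w : Fin 3 → K, w i = 0 → (w ∈ B ↔ (∀ b ∈ B, Valued.v (pairing σ H b w) ≤ 1) ∧ Valued.v (pairing σ H x₀ w) ≤ 1))
    (hiso : Valued.v (pairing σ H x₀ x₀) ≤ 1) {d : K} (hd : Valued.v d * Valued.v (x₀ i) ≤ 1) :
    (Pi.single i d : Fin 3 → K) ∈ B ⊔ Submodule.span 𝒪[K] {x₀} := by
  have hx0 : x₀ i ≠ 0 := fun h => by rw [h, map_zero] at hx₀; exact not_lt_zero hx₀
  have hvx : Valued.v (x₀ i) ≠ 0 := (Valuation.ne_zero_iff _).2 hx0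
  -- `s = d / c₀`: `|s|·|c₀|² = |d|·|c₀| ≤ 1`, `|s| ≤ 1`
  have hs : Valued.v (d / x₀ i) * (Valued.v (x₀ i) * Valued.v (x₀ i)) ≤ 1 := by
    rwa [map_div₀, ← mul_assoc, div_mul_cancel₀ _ hvx]
  have hs1 : Valued.v (d / x₀ i) ≤ 1 := by
    rw [map_div₀, div_le_iff₀ (zero_lt_iff.2 hvx), one_mul]
    exact le_trans (le_mul_of_one_le_right' hx₀.le) (hd.trans hx₀.le)
  have hw := smul_sub_single_mem_of_glue hvσ hsymm hHcol hhi hBW hx₀ hdual hiso hs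
  rw [mem_sup_span_singleton_iff]
  refine ⟨d / x₀ i, hs1, ?_⟩
  have e : (Pi.single i d : Fin 3 → K) - (d / x₀ i) • x₀ = -((d / x₀ i) • (x₀ - Pi.single i (x₀ i))) := by
    rw [smul_sub, neg_sub, ← Pi.single_smul', smul_eq_mul, div_mul_cancel₀ _ hx0]
  rw [e]
  exact B.neg_mem hw

/-- **`B ⊔ 𝒪x₀ ≤ (B ⊔ 𝒪x₀)^♯`** under (G1)(G2) (integrality of the glued Gram matrix). [cite: Jacobowitz1962, §4] -/
theorem le_dualLatt_sup_span_of_glue (hvσ : ∀ a, Valued.v (σ a) = Valued.v a) (hsymm : ∀ x y : Fin 3 → K, Valued.v (pairing σ H y x) = Valued.v (pairing σ H x y))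
    (hBW : ∀ b ∈ B, b i = 0)
    (hdual : ∀ w : Fin 3 → K, w i = 0 → (w ∈ B ↔ (∀ b ∈ B, Valued.v (pairing σ H b w) ≤ 1) ∧ Valued.v (pairing σ H x₀ w) ≤ 1))
    (hiso : Valued.v (pairing σ H x₀ x₀) ≤ 1) :
    B ⊔ Submodule.span 𝒪[K] {x₀} ≤ dualLatt σ H (B ⊔ Submodule.span 𝒪[K] {x₀}) := by
  intro y hy
  obtain ⟨t, ht, hb⟩ := mem_sup_span_singleton_iff.1 hy
  have hb' := (hdual _ (by rw [hBW _ hb])).1 hb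
  have e : y = (y - t • x₀) + t • x₀ := (sub_add_cancel _ _).symm
  rw [mem_dualLatt_sup_span_iff hvσ]
  refine ⟨fun b hbB => ?_, ?_⟩
  · rw [e, map_add, map_smul, smul_eq_mul]
    refine (Valuation.map_add _ _ _).trans (max_le (hb'.1 b hbB) ?_)
    rw [map_mul, hsymm x₀ b]
    · exact mul_le_one' ht ((hdual b (hBW b hbB)).1 hbB).2
  · rw [e, map_add, map_smul, smul_eq_mul]
    refine (Valuation.map_add _ _ _).trans (max_le hb'.2 ?_)
    rw [map_mul]
    exact mul_le_one' ht hiso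

/-- **THE GLUING THEOREM: `(B ⊔ 𝒪x₀)^♯ = B ⊔ 𝒪x₀`** — the lattice glued from a W-lattice `B ⊆ W_i` and `x₀ = w₀ + c₀e_i` (`|c₀| > 1`) is SELF-DUAL as soon as (G1) `B` is the
`W_i`-dual of `B + 𝒪w₀` (`w ∈ W_i`: `w ∈ B ⟺ |⟨B, w⟩| ≤ 1 ∧ |⟨x₀, w⟩| ≤ 1`) and (G2) `|⟨x₀, x₀⟩| ≤ 1` (form block at `i`, `|H_{ii}| = 1`, `|⟨y,x⟩| = |⟨x,y⟩|`, `σ` valuation-preserving).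
Proof of `⊆`: `c₀⁻¹e_i ∈ M` bounds `|y_i| ≤ |c₀|` for `y ∈ M^♯`, and `y − (y_i∕c₀)x₀ ∈ W_i ∩ M^♯ = B` by (G1). [cite: Jacobowitz1962, §4] [cite: BruhatTits1972, §10] [cite: Kottwitz1986, §3] -/
theorem dualLatt_sup_span_eq_of_glue (hvσ : ∀ a, Valued.v (σ a) = Valued.v a) (hsymm : ∀ x y : Fin 3 → K, Valued.v (pairing σ H y x) = Valued.v (pairing σ H x y))
    (hHrow : ∀ l, l ≠ i → H i l = 0) (hHcol : ∀ l, l ≠ i → H l i = 0) (hhi : Valued.v (H i i) = 1) (hBW : ∀ b ∈ B, b i = 0) (hx₀ : 1 < Valued.v (x₀ i))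
    (hdual : ∀ w : Fin 3 → K, w i = 0 → (w ∈ B ↔ (∀ b ∈ B, Valued.v (pairing σ H b w) ≤ 1) ∧ Valued.v (pairing σ H x₀ w) ≤ 1))
    (hiso : Valued.v (pairing σ H x₀ x₀) ≤ 1) :
    dualLatt σ H (B ⊔ Submodule.span 𝒪[K] {x₀}) = B ⊔ Submodule.span 𝒪[K] {x₀} := by
  have hle := le_dualLatt_sup_span_of_glue hvσ hsymm hBW hdual hiso
  refine le_antisymm (fun y hy => ?_) hle
  have hx0 : x₀ i ≠ 0 := fun h => by rw [h, map_zero] at hx₀; exact not_lt_zero hx₀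
  have hvx : Valued.v (x₀ i) ≠ 0 := (Valuation.ne_zero_iff _).2 hx0
  -- `|y_i| ≤ |c₀|`: pair `y` with `c₀⁻¹ e_i ∈ M`
  have hei : (Pi.single i (x₀ i)⁻¹ : Fin 3 → K) ∈ B ⊔ Submodule.span 𝒪[K] {x₀} :=
    single_mem_sup_span_of_glue hvσ hsymm hHcol hhi hBW hx₀ hdual hiso (by rw [map_inv₀, inv_mul_cancel₀ hvx])
  have hyi : Valued.v (y i) ≤ Valued.v (x₀ i) := by
    have h := (mem_dualLatt σ H _ y).1 hy _ hei
    rw [pairing_single_left_of_block σ H i hHrow, map_mul, map_mul, hvσ, hhi, mul_one, map_inv₀,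
      inv_mul_le_iff₀ (zero_lt_iff.2 hvx), mul_one] at h
    exact h
  -- `t = y_i / c₀`, `w′ = y − t x₀ ∈ W_i`
  have ht : Valued.v (y i / x₀ i) ≤ 1 := by rwa [map_div₀, div_le_one₀ (zero_lt_iff.2 hvx)]
  have hwi : (y - (y i / x₀ i) • x₀) i = 0 := by
    rw [Pi.sub_apply, Pi.smul_apply, smul_eq_mul, div_mul_cancel₀ _ hx0, sub_self]
  obtain ⟨hB, hx⟩ := (mem_dualLatt_sup_span_iff hvσ H B x₀ y).1 hy
  rw [mem_sup_span_singleton_iff]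
  refine ⟨y i / x₀ i, ht, (hdual _ hwi).2 ⟨fun b hb => ?_, ?_⟩⟩
  · rw [map_sub, map_smul, smul_eq_mul]
    refine (Valuation.map_sub _ _ _).trans (max_le (hB b hb) ?_)
    rw [map_mul, hsymm x₀ b]
    exact mul_le_one' ht ((hdual b (hBW b hb)).1 hb).2
  · rw [map_sub, map_smul, smul_eq_mul]
    refine (Valuation.map_sub _ _ _).trans (max_le hx ?_)
    rw [map_mul]
    exact mul_le_one' ht hiso

/-! ## §4 The line part `M ∩ Ke_i = c₀⁻¹𝒪e_i` and the gluing classes `c₀ mod 𝒪c₀⁻¹` -/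

/-- **`d·e_i ∈ B ⊔ 𝒪x₀ ⟺ |d|·|c₀| ≤ 1`** under (G1)(G2): the line part of the glued lattice is `c₀⁻¹𝒪e_i` (tube coordinate `a = v(c₀⁻¹)`, cyclic quotient of length `2a`).
[cite: Jacobowitz1962, §4] [cite: BruhatTits1972, §10] -/
theorem single_mem_sup_span_iff_of_glue (hvσ : ∀ a, Valued.v (σ a) = Valued.v a) (hsymm : ∀ x y : Fin 3 → K, Valued.v (pairing σ H y x) = Valued.v (pairing σ H x y))
    (hHcol : ∀ l, l ≠ i → H l i = 0) (hhi : Valued.v (H i i) = 1) (hBW : ∀ b ∈ B, b i = 0) (hx₀ : 1 < Valued.v (x₀ i))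
    (hdual : ∀ w : Fin 3 → K, w i = 0 → (w ∈ B ↔ (∀ b ∈ B, Valued.v (pairing σ H b w) ≤ 1) ∧ Valued.v (pairing σ H x₀ w) ≤ 1))
    (hiso : Valued.v (pairing σ H x₀ x₀) ≤ 1) (d : K) :
    (Pi.single i d : Fin 3 → K) ∈ B ⊔ Submodule.span 𝒪[K] {x₀} ↔ Valued.v d * Valued.v (x₀ i) ≤ 1 := by
  refine ⟨fun hd => ?_, single_mem_sup_span_of_glue hvσ hsymm hHcol hhi hBW hx₀ hdual hiso⟩
  -- pair `d e_i ∈ M ≤ M^♯` with `x₀ ∈ M`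
  have h := (mem_dualLatt σ H _ _).1 (le_dualLatt_sup_span_of_glue hvσ hsymm hBW hdual hiso hd) x₀
    (Submodule.mem_sup_right (Submodule.mem_span_singleton_self x₀))
  rw [pairing_single_right_of_block σ H i hHcol, map_mul, map_mul, hvσ, hhi, mul_one, mul_comm] at h
  exact h

/-- **GLUING CLASSES**: under (G1)(G2) for `x₀`, the shifted generator `x₀ + d e_i` with `|d|·|c₀| ≤ 1` glues the SAME lattice: `B ⊔ 𝒪(x₀ + d e_i) = B ⊔ 𝒪x₀` — the parameter
`c₀` matters only modulo `𝒪·c₀⁻¹` (`|c₀|²∕unit` classes of level `2a`; with §4's converse the classes are exactly these). [cite: Jacobowitz1962, §4] [cite: BruhatTits1972, §10] -/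
theorem sup_span_eq_sup_span_of_glue (hvσ : ∀ a, Valued.v (σ a) = Valued.v a) (hsymm : ∀ x y : Fin 3 → K, Valued.v (pairing σ H y x) = Valued.v (pairing σ H x y))
    (hHrow : ∀ l, l ≠ i → H i l = 0) (hHcol : ∀ l, l ≠ i → H l i = 0) (hhi : Valued.v (H i i) = 1) (hBW : ∀ b ∈ B, b i = 0) (hx₀ : 1 < Valued.v (x₀ i))
    (hdual : ∀ w : Fin 3 → K, w i = 0 → (w ∈ B ↔ (∀ b ∈ B, Valued.v (pairing σ H b w) ≤ 1) ∧ Valued.v (pairing σ H x₀ w) ≤ 1))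
    (hiso : Valued.v (pairing σ H x₀ x₀) ≤ 1) {d : K} (hd : Valued.v d * Valued.v (x₀ i) ≤ 1) :
    B ⊔ Submodule.span 𝒪[K] {x₀ + Pi.single i d} = B ⊔ Submodule.span 𝒪[K] {x₀} := by
  have hdM := single_mem_sup_span_of_glue hvσ hsymm hHcol hhi hBW hx₀ hdual hiso hd
  have hd1 : Valued.v d ≤ 1 := (le_mul_of_one_le_right' hx₀.le).trans hd
  -- `|d| < |c₀|`, so `|x₁,i| = |c₀|` for the shifted generator `x₁ = x₀ + d e_i` (named, to keep unification first-order)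
  have hdlt : Valued.v d < Valued.v (x₀ i) := by
    by_contra hge
    rw [not_lt] at hge
    exact lt_irrefl (1 : ℤᵐ⁰) (lt_of_lt_of_le (one_lt_mul_of_lt_of_le hx₀ hx₀.le) ((mul_le_mul' hge le_rfl).trans hd))
  obtain ⟨x₁, hx₁⟩ : ∃ x₁ : Fin 3 → K, x₁ = x₀ + Pi.single i d := ⟨_, rfl⟩
  rw [← hx₁]
  have hx₁i : x₁ i = x₀ i + d := by rw [hx₁]; simp
  have hvx₁ : Valued.v (x₁ i) = Valued.v (x₀ i) := by rw [hx₁i, Valuation.map_add_eq_of_lt_left _ hdlt]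
  have hx₁' : 1 < Valued.v (x₁ i) := by rw [hvx₁]; exact hx₀
  -- (G1) transfers: `⟨x₁, w⟩ = ⟨x₀, w⟩` on `W_i`
  have hpW : ∀ w : Fin 3 → K, w i = 0 → pairing σ H x₁ w = pairing σ H x₀ w := fun w hw => by
    rw [hx₁, map_add, LinearMap.add_apply, pairing_single_left_of_block σ H i hHrow, hw, mul_zero, add_zero]
  have hdual₁ : ∀ w : Fin 3 → K, w i = 0 → (w ∈ B ↔ (∀ b ∈ B, Valued.v (pairing σ H b w) ≤ 1) ∧ Valued.v (pairing σ H x₁ w) ≤ 1) :=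
    fun w hw => by rw [hpW w hw]; exact hdual w hw
  -- (G2) transfers: the cross terms have `|·| = |d|·|c₀| ≤ 1`
  have hiso₁ : Valued.v (pairing σ H x₁ x₁) ≤ 1 := by
    rw [hx₁, LinearMap.map_add₂, (pairing σ H x₀).map_add, (pairing σ H (Pi.single i d)).map_add, pairing_single_right_of_block σ H i hHcol,
      pairing_single_left_of_block σ H i hHrow, pairing_single_left_of_block σ H i hHrow, Pi.single_eq_same]
    refine Valuation.map_add_le _ (Valuation.map_add_le _ hiso ?_) (Valuation.map_add_le _ ?_ ?_)
    · rw [map_mul, map_mul, hvσ, hhi, mul_one, mul_comm]; exact hd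
    · rw [map_mul, map_mul, hvσ, hhi, mul_one]; exact hd
    · rw [map_mul, map_mul, hvσ, hhi, mul_one]; exact mul_le_one' hd1 hd1
  have hd₁ : Valued.v d * Valued.v (x₁ i) ≤ 1 := by rw [hvx₁]; exact hd
  have hdM₁ : (Pi.single i d : Fin 3 → K) ∈ B ⊔ Submodule.span 𝒪[K] {x₁} := single_mem_sup_span_of_glue hvσ hsymm hHcol hhi hBW hx₁' hdual₁ hiso₁ hd₁
  refine le_antisymm (sup_le le_sup_left (Submodule.span_le.2 (Set.singleton_subset_iff.2 ?_)))
    (sup_le le_sup_left (Submodule.span_le.2 (Set.singleton_subset_iff.2 ?_)))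
  · rw [hx₁]
    exact Submodule.add_mem _ (Submodule.mem_sup_right (Submodule.mem_span_singleton_self x₀)) hdM
  · have h := Submodule.sub_mem _ (Submodule.mem_sup_right (Submodule.mem_span_singleton_self x₁)) hdM₁
    rw [hx₁, add_sub_cancel_right] at h
    rw [hx₁]; exact h

end Glue

end Literature.NumberTheory.Automorphic.UnitaryLatticeTree

end
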